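import Summits.CriticalPhenomena.PercolationContinuityZ3.Theorems.PercNearOneGluingAdditiveGluingCovTransferCertAlgebra
import Summits.CriticalPhenomena.PercolationContinuityZ3.Theorems.PercNearOneGluingNoHeavyLowerTailOneCutCertSound

/-!
# `AdditiveGluing` (crux stmt-CriticalPhenomena-4576), kernel (T) = `stub_k0CovTransferQ_c9`: the computable
# three-copy checker and its soundness

Support file (certificate seat `prim-cert-2`; `--supports stmt-CriticalPhenomena-4576`).  For a vertex count `n` and a role
tuple `(o, b, u, v, c)` the covariance transfer (T) reads, with `μ = prodBernoulli w` and `xy = {x ↔ y}`,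

  `μ(uvᶜ)·(μ(uvᶜ ∩ ub ∩ vo)·μ(cuᶜ ∩ cvᶜ) − μ(uvᶜ ∩ ub ∩ vc)·μ(cuᶜ ∩ cvᶜ ∩ oc))
     ≤ μ(uvᶜ ∩ ub)·(μ(uvᶜ ∩ vo)·μ(cuᶜ ∩ cvᶜ) − μ(uvᶜ ∩ vc)·μ(cuᶜ ∩ cvᶜ ∩ oc))`,

i.e. `0 ≤` a signed sum of four products of three probabilities of CONNECTIVITY EVENTS (events of the form
`{ω | P(connectivity relation of ω)}`).  Each such probability is the multilinear polynomial of a `0/1` corner table read off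
the reach tables of `…OneCutCertCheck` (`real_connEvent_eq_ML`), so `RHS − LHS` is a `cubicForm` of
`…CovTransferCertAlgebra`.  `checkT n o b u v c σ` builds the eight tables, the base-`2^σ` Kronecker numbers by shifts (`krN4`,
base-4 positions), the certificate number `Z + offset` and the AND-mask digit test of `…OneCutCertCheck`; `covTransferQ_of_checkT`:
if it returns `true` then (T) holds at `(n, w, o, b, u, v, c)` for EVERY weight vector `w`.  The evaluations (`native_decide`,
COMPUTATIONAL) and the theorem for `n ≤ 5` are in `…CovTransferCertLeFive`.

Why the check succeeds on small graphs: lead c12's (CNT) — all three-replica fibre counts of (T) are nonnegative (crux directory,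
LeadMath-c12; `…AdditiveGluingFibreCriterion`); `checkT` verifies exactly these `4^m` fibre sums (`cubicCoef`) through the digits.
Nothing here asserts anything about the crux for a specific `n`.
-/

namespace Summit.CriticalPhenomena.PercolationContinuityZ3.Theorems.CovTransferCert

open Finset MeasureTheory OneCutCert
open scoped BigOperators
open Literature.Probability.Percolation Literature.Probability.LatticeModels
open Summit.CriticalPhenomena.PercolationContinuityZ3.Theorems.AdditiveGluing.Negative.Cert

variable {n : ℕ}

/-! ## Base-4 Kronecker numbers of list tables, by shifts -/

/-- `e4` of a `snoc`. [this work] -/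
theorem e4_snoc {m : ℕ} (g : Fin m → Bool) (b : Bool) :
    e4 (Fin.snoc g b : Fin (m + 1) → Bool) = e4 g + b.toNat * 4 ^ m := by
  unfold e4
  rw [Fin.sum_univ_castSucc]
  simp only [Fin.snoc_castSucc, Fin.snoc_last, Fin.val_castSucc, Fin.val_last]

/-- Fast base-`2^s` Kronecker number (base-4 positions) of an integer list-table of length `2^L`. [this work] -/
def krL4 (s : ℕ) : ℕ → List ℤ → ℤ
  | 0, l => l.getD 0 0
  | L + 1, l => krL4 s L (l.take (2 ^ L)) + krL4 s L (l.drop (2 ^ L)) * (2 : ℤ) ^ (s * 4 ^ L)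

/-- **Correctness of `krL4`**: `krL4 s L l = KR4 (2^s) (tabOf l)` for `l.length = 2^L`. [this work] -/
theorem krL4_eq : ∀ (s L : ℕ) (l : List ℤ), l.length = 2 ^ L → krL4 s L l = KR4 (2 ^ s) (tabOf (m := L) l)
  | s, 0, l, hl => by
    unfold krL4 KR4 tabOf
    simp [enc2, e4]
  | s, L + 1, l, hl => by
    have h1 : (l.take (2 ^ L)).length = 2 ^ L := by rw [List.length_take, hl, pow_succ]; omega
    have h2 : (l.drop (2 ^ L)).length = 2 ^ L := by rw [List.length_drop, hl, pow_succ]; omega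
    unfold krL4
    rw [krL4_eq s L _ h1, krL4_eq s L _ h2]
    unfold KR4
    rw [sum_corner_succ, Finset.sum_mul]
    congr 1
    · refine Finset.sum_congr rfl fun g _ => ?_
      unfold tabOf
      rw [enc2_snoc, e4_snoc]
      simp only [Bool.toNat_false, zero_mul, add_zero]
      rw [List.getD_eq_getElem?_getD, List.getD_eq_getElem?_getD, List.getElem?_take_of_lt (enc2_lt g)]
    · refine Finset.sum_congr rfl fun g _ => ?_
      unfold tabOf
      rw [enc2_snoc, e4_snoc]
      simp only [Bool.toNat_true, one_mul]
      rw [List.getD_eq_getElem?_getD, List.getD_eq_getElem?_getD, List.getElem?_drop, add_comm (2 ^ L),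
        pow_add, mul_assoc, two_pow_mul_cast]

/-- Fast Kronecker number of a list-table of NATURALS (base-4 positions), by shifts. [this work] -/
def krN4 (s : ℕ) : ℕ → List ℕ → ℕ
  | 0, l => l.getD 0 0
  | L + 1, l => krN4 s L (l.take (2 ^ L)) + (krN4 s L (l.drop (2 ^ L))) <<< (s * 4 ^ L)

/-- `krN4` agrees with `krL4` on the casts. [this work] -/
theorem krN4_eq_krL4 : ∀ (s L : ℕ) (l : List ℕ), (krN4 s L l : ℤ) = krL4 s L (l.map ((↑) : ℕ → ℤ))
  | s, 0, l => by simp [krN4, krL4, List.getD_eq_getElem?_getD, List.getElem?_map]; cases l[0]? <;> simp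
  | s, L + 1, l => by
    unfold krN4 krL4
    rw [Nat.shiftLeft_eq, ← List.map_take, ← List.map_drop]
    push_cast
    rw [krN4_eq_krL4 s L, krN4_eq_krL4 s L]

/-- **Correctness of `krN4`.** [this work] -/
theorem krN4_eq (s L : ℕ) (l : List ℕ) (hl : l.length = 2 ^ L) :
    (krN4 s L l : ℤ) = KR4 (2 ^ s) (tabOf (m := L) (l.map ((↑) : ℕ → ℤ))) := by
  rw [krN4_eq_krL4, krL4_eq s L _ (by rw [List.length_map, hl])]

/-! ## Connectivity events and their tables -/

/-- A Boolean connectivity relation on `Fin n`. [this work] -/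
abbrev CRel (n : ℕ) : Type := Fin n → Fin n → Bool

open Classical in
/-- The event "the connectivity relation of the configuration satisfies `P`". [this work] -/
def connEvent (P : CRel n → Bool) : Set (BondConfig (Fin n)) :=
  {ω | P (fun a b => decide (ω ∈ openConn a b)) = true}

/-- The `0/1` list table of a connectivity predicate from a list of reach tables. [this work] -/
def evTabRT (base : List (List ℕ)) (P : CRel n → Bool) : List ℕ :=
  base.map fun rt => if P (fun a b => (rt.getD a.val 0).testBit b.val) then 1 else 0

/-- The `0/1` list table (indexed by bitmask corner) of a connectivity event, from the shared reach tables. [this work] -/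
def evTab (n : ℕ) (P : CRel n → Bool) : List ℕ := evTabRT (baseRT n) P

/-- Length of `evTab`. [this work] -/
theorem length_evTab (P : CRel n → Bool) : (evTab n P).length = 2 ^ mE n := by
  simp [evTab, evTabRT, baseRT]

/-- The integer corner table of a connectivity event. [this work] -/
def tabT (n : ℕ) (P : CRel n → Bool) : (Fin (mE n) → Bool) → ℤ := tabOf ((evTab n P).map ((↑) : ℕ → ℤ))

/-- Entries of `tabT`: the indicator of `P` at the corner. [this work] -/
theorem tabT_apply (P : CRel n → Bool) (g : Fin (mE n) → Bool) : tabT n P g = if P (connB g) then 1 else 0 := by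
  unfold tabT tabOf evTab evTabRT baseRT
  rw [List.getD_eq_getElem?_getD, List.map_map, List.getElem?_map, List.getElem?_map,
    List.getElem?_range (enc2_lt g)]
  simp only [Option.map_some, Option.getD_some, Function.comp, cfgM_enc2]
  unfold connB
  split_ifs <;> simp

/-- `|tabT| ≤ 1`. [this work] -/
theorem abs_tabT_le (P : CRel n → Bool) (g : Fin (mE n) → Bool) : |tabT n P g| ≤ 1 := by
  rw [tabT_apply]; split_ifs <;> simp

open Classical in
/-- **Probability of a connectivity event as a multilinear polynomial of its table.** [this work] -/
theorem real_connEvent_eq_ML (w : Sym2 (Fin n) → unitInterval) (P : CRel n → Bool) :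
    (prodBernoulli w).real (connEvent P) = ML (fun g => (tabT n P g : ℝ)) (xOf w) := by
  have hB : ∀ ω ω' : Set (Sym2 (Fin n)), openGraph ω = openGraph ω' → (ω ∈ connEvent P ↔ ω' ∈ connEvent P) := by
    intro ω ω' h
    have hr : (fun a b => decide (ω ∈ openConn a b)) = (fun a b => decide (ω' ∈ openConn a b)) := by
      funext a b
      rw [Bool.eq_iff_iff, decide_eq_true_iff, decide_eq_true_iff]
      exact openConn_of_openGraph a b ω ω' h
    simp only [connEvent, Set.mem_setOf_eq, hr]
  rw [real_eq_ML w (connEvent P) hB]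
  congr 1
  funext g
  have hr : (fun a b => decide ((↑(Eset (cfg g)) : Set (Sym2 (Fin n))) ∈ openConn a b)) = connB g := by
    funext a b
    rw [Bool.eq_iff_iff, decide_eq_true_iff, connB_iff]
  unfold evT
  simp only [connEvent, Set.mem_setOf_eq, hr, tabT_apply]
  split_ifs <;> simp

/-! ## The data of (T) -/

/-- `N = {c ↮ u} ∩ {c ↮ v}`. [this work] -/
def pN (c u v : Fin n) : CRel n → Bool := fun r => (!(r c u)) && (!(r c v))
/-- `N ∩ {o ↔ c}`. [this work] -/
def pNoc (o c u v : Fin n) : CRel n → Bool := fun r => ((!(r c u)) && (!(r c v))) && r o c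
/-- `D = {u ↮ v}`. [this work] -/
def pD (u v : Fin n) : CRel n → Bool := fun r => !(r u v)
/-- `D ∩ {u ↔ b}`. [this work] -/
def pDub (u v b : Fin n) : CRel n → Bool := fun r => (!(r u v)) && r u b
/-- `D ∩ {v ↔ o}`. [this work] -/
def pDvo (u v o : Fin n) : CRel n → Bool := fun r => (!(r u v)) && r v o
/-- `D ∩ {v ↔ c}`. [this work] -/
def pDvc (u v c : Fin n) : CRel n → Bool := fun r => (!(r u v)) && r v c
/-- `D ∩ {u ↔ b} ∩ {v ↔ o}`. [this work] -/
def pDubvo (u v b o : Fin n) : CRel n → Bool := fun r => ((!(r u v)) && r u b) && r v o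
/-- `D ∩ {u ↔ b} ∩ {v ↔ c}`. [this work] -/
def pDubvc (u v b c : Fin n) : CRel n → Bool := fun r => ((!(r u v)) && r u b) && r v c

/-- Signs of the four cubic terms of `RHS − LHS` of (T). [this work] -/
def sgnT : Fin 4 → ℤ := ![1, -1, -1, 1]
/-- First factors: `D∩ub, D∩ub, D, D`. [this work] -/
def XP (b u v : Fin n) : Fin 4 → (CRel n → Bool) := ![pDub u v b, pDub u v b, pD u v, pD u v]
/-- Second factors: `D∩vo, D∩vc, D∩ub∩vo, D∩ub∩vc`. [this work] -/
def YP (o b u v c : Fin n) : Fin 4 → (CRel n → Bool) := ![pDvo u v o, pDvc u v c, pDubvo u v b o, pDubvc u v b c]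
/-- Third factors: `N, N∩oc, N, N∩oc`. [this work] -/
def ZP (o u v c : Fin n) : Fin 4 → (CRel n → Bool) := ![pN c u v, pNoc o c u v, pN c u v, pNoc o c u v]

/-- The `RHS − LHS` of (T) as a cubic form of the eight `0/1` tables. [this work] -/
theorem cubicForm_T_eq (w : Sym2 (Fin n) → unitInterval) (o b u v c : Fin n) :
    cubicForm sgnT (fun j => tabT n (XP b u v j)) (fun j => tabT n (YP o b u v c j)) (fun j => tabT n (ZP o u v c j)) (xOf w) =
      (prodBernoulli w).real (connEvent (pDub u v b)) * (prodBernoulli w).real (connEvent (pDvo u v o)) *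
          (prodBernoulli w).real (connEvent (pN c u v)) -
        (prodBernoulli w).real (connEvent (pDub u v b)) * (prodBernoulli w).real (connEvent (pDvc u v c)) *
          (prodBernoulli w).real (connEvent (pNoc o c u v)) -
        (prodBernoulli w).real (connEvent (pD u v)) * (prodBernoulli w).real (connEvent (pDubvo u v b o)) *
          (prodBernoulli w).real (connEvent (pN c u v)) +
        (prodBernoulli w).real (connEvent (pD u v)) * (prodBernoulli w).real (connEvent (pDubvc u v b c)) *
          (prodBernoulli w).real (connEvent (pNoc o c u v)) := by
  simp only [cubicForm, Fin.sum_univ_four, sgnT, XP, YP, ZP, Matrix.cons_val_zero, Matrix.cons_val_one,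
    Matrix.cons_val, real_connEvent_eq_ML]
  push_cast
  ring

/-! ## The checker -/

/-- The certificate number of (T) at `(n, o, b, u, v, c)` in base `2^σ`, from a list of reach tables: the signed combination
of the four triple products of Kronecker numbers (`RHS − LHS`). [this work] -/
def zT (base : List (List ℕ)) (n : ℕ) (o b u v c : Fin n) (σ : ℕ) : ℤ :=
  let m := mE n
  let K : (CRel n → Bool) → ℤ := fun P => (krN4 σ m (evTabRT base P) : ℤ)
  let kD := K (pD u v)
  let kDub := K (pDub u v b)
  let kDvo := K (pDvo u v o)
  let kDvc := K (pDvc u v c)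
  let kDubvo := K (pDubvo u v b o)
  let kDubvc := K (pDubvc u v b c)
  let kN := K (pN c u v)
  let kNoc := K (pNoc o c u v)
  kDub * kDvo * kN - kDub * kDvc * kNoc - kD * kDubvo * kN + kD * kDubvc * kNoc

/-- The offset `2^(σ-1) · Σ_{j < 4^m} (2^σ)^j` in closed form. [this work] -/
def offT (σ m : ℕ) : ℤ := 2 ^ (σ - 1) * (((2 : ℤ) ^ (σ * 4 ^ m) - 1) / (2 ^ σ - 1))

/-- The (T) certificate CHECK at `(n, o, b, u, v, c)` in base `2^σ` with the reach tables `base` (must be `baseRT n`):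
all `4^m` three-copy fibre sums of `RHS − LHS` are nonnegative, read off the digits of `zT + offT`. [this work] -/
def checkTW (base : List (List ℕ)) (n : ℕ) (o b u v c : Fin n) (σ : ℕ) : Bool :=
  let m := mE n
  let Z := zT base n o b u v c σ + offT σ m
  decide (σ = 3 * m + 4) && decide (0 ≤ Z) && decide ((Z.toNat &&& (offT σ m).toNat) = (offT σ m).toNat)

/-- The (T) certificate check with the canonical reach tables. [this work] -/
def checkT (n : ℕ) (o b u v c : Fin n) (σ : ℕ) : Bool := checkTW (baseRT n) n o b u v c σ

/-- The check for a list of role tuples, sharing the reach tables. [this work] -/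
def checkList (n σ : ℕ) (ts : List (Fin n × Fin n × Fin n × Fin n × Fin n)) : Bool :=
  let base := baseRT n
  ts.all fun t => checkTW base n t.1 t.2.1 t.2.2.1 t.2.2.2.1 t.2.2.2.2 σ

/-- `checkList` certifies each listed tuple. [this work] -/
theorem checkT_of_checkList {σ : ℕ} {ts : List (Fin n × Fin n × Fin n × Fin n × Fin n)} (h : checkList n σ ts = true)
    {o b u v c : Fin n} (ht : (o, b, u, v, c) ∈ ts) : checkT n o b u v c σ = true := by
  have h' : ∀ t ∈ ts, checkTW (baseRT n) n t.1 t.2.1 t.2.2.1 t.2.2.2.1 t.2.2.2.2 σ = true := by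
    simpa only [checkList, List.all_eq_true] using h
  exact h' (o, b, u, v, c) ht

/-- Fibre sums of `0/1`-bounded tables are at most `8^m` in absolute value. [this work] -/
theorem abs_pcoef3_le {m : ℕ} (A B C : (Fin m → Bool) → ℤ) (hA : ∀ g, |A g| ≤ 1) (hB : ∀ g, |B g| ≤ 1)
    (hC : ∀ g, |C g| ≤ 1) (k : Fin m → Fin 4) : |pcoef3 A B C k| ≤ 8 ^ m := by
  classical
  unfold pcoef3
  have hterm : ∀ g h l : Fin m → Bool, |(if key3 g h l = k then A g * B h * C l else 0)| ≤ 1 := by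
    intro g h l
    split_ifs
    · rw [abs_mul, abs_mul]
      exact mul_le_one₀ (mul_le_one₀ (hA g) (abs_nonneg _) (hB h)) (abs_nonneg _) (hC l)
    · simp
  have hcard : (Finset.univ : Finset (Fin m → Bool)).card = 2 ^ m := by
    rw [Finset.card_univ, Fintype.card_fun, Fintype.card_bool, Fintype.card_fin]
  calc |∑ g, ∑ h, ∑ l, (if key3 g h l = k then A g * B h * C l else 0)|
      ≤ ∑ g, |∑ h, ∑ l, (if key3 g h l = k then A g * B h * C l else 0)| := Finset.abs_sum_le_sum_abs _ _
    _ ≤ ∑ g : Fin m → Bool, ∑ h : Fin m → Bool, ∑ l : Fin m → Bool, (1 : ℤ) := by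
        refine Finset.sum_le_sum fun g _ => (Finset.abs_sum_le_sum_abs _ _).trans (Finset.sum_le_sum fun h _ =>
          (Finset.abs_sum_le_sum_abs _ _).trans (Finset.sum_le_sum fun l _ => hterm g h l))
    _ = 8 ^ m := by
        simp only [Finset.sum_const, hcard, nsmul_eq_mul, mul_one]
        push_cast
        rw [show (8 : ℤ) = 2 ^ 3 by norm_num, ← pow_mul]
        ring

/-- **Soundness of `checkT`**: the cubic form `RHS − LHS` of (T) is nonnegative at every weight vector. [this work] -/
theorem cubicForm_nonneg_of_checkT (o b u v c : Fin n) (σ : ℕ) (h : checkT n o b u v c σ = true)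
    (w : Sym2 (Fin n) → unitInterval) :
    0 ≤ cubicForm sgnT (fun j => tabT n (XP b u v j)) (fun j => tabT n (YP o b u v c j))
      (fun j => tabT n (ZP o u v c j)) (xOf w) := by
  unfold checkT checkTW at h
  simp only [Bool.and_eq_true, decide_eq_true_eq] at h
  obtain ⟨⟨hσ, hZ⟩, hland⟩ := h
  set m := mE n with hm
  have hσpos : 0 < σ := by omega
  -- the offset is `maskN σ (4^m)`
  have hoff : offT σ m = (maskN σ (4 ^ m) : ℤ) := by
    unfold offT
    rw [off_eq σ (4 ^ m) hσpos, maskN_eq_sum σ hσpos, Finset.mul_sum]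
  rw [hoff] at hZ hland
  rw [Int.toNat_natCast] at hland
  -- the tables and the certificate number
  set X : Fin 4 → (Fin m → Bool) → ℤ := fun j => tabT n (XP b u v j) with hX
  set Y : Fin 4 → (Fin m → Bool) → ℤ := fun j => tabT n (YP o b u v c j) with hY
  set Z3 : Fin 4 → (Fin m → Bool) → ℤ := fun j => tabT n (ZP o u v c j) with hZ3
  have hK : ∀ P : CRel n → Bool, (krN4 σ m (evTab n P) : ℤ) = KR4 (2 ^ σ) (tabT n P) := fun P =>
    krN4_eq σ m _ (length_evTab P)
  have hZeq : zT (baseRT n) n o b u v c σ = cubicZ (2 ^ σ) sgnT X Y Z3 := by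
    unfold zT cubicZ
    simp only [Fin.sum_univ_four, sgnT, hX, hY, hZ3, XP, YP, ZP, Matrix.cons_val_zero, Matrix.cons_val_one,
      Matrix.cons_val, ← hm]
    rw [← evTab, ← evTab, ← evTab, ← evTab, ← evTab, ← evTab, ← evTab, ← evTab, hK, hK, hK, hK, hK, hK, hK, hK]
    ring
  -- the bound on the fibre sums
  have hB : CoefBound3 sgnT X Y Z3 (2 ^ (σ - 1)) := by
    intro k
    have h8 : ∀ j, |sgnT j * pcoef3 (X j) (Y j) (Z3 j) k| ≤ 8 ^ m := by
      intro j
      rw [abs_mul]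
      have hs : |sgnT j| = 1 := by fin_cases j <;> simp [sgnT]
      rw [hs, one_mul]
      exact abs_pcoef3_le _ _ _ (abs_tabT_le _) (abs_tabT_le _) (abs_tabT_le _) k
    have hsum : |cubicCoef sgnT X Y Z3 k| ≤ 4 * 8 ^ m := by
      unfold cubicCoef
      calc |∑ j : Fin 4, sgnT j * pcoef3 (X j) (Y j) (Z3 j) k| ≤ ∑ j : Fin 4, |sgnT j * pcoef3 (X j) (Y j) (Z3 j) k| :=
            Finset.abs_sum_le_sum_abs _ _
        _ ≤ ∑ _j : Fin 4, (8 : ℤ) ^ m := Finset.sum_le_sum fun j _ => h8 j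
        _ = 4 * 8 ^ m := by simp
    have hpow : (4 : ℤ) * 8 ^ m < (2 : ℕ) ^ (σ - 1) := by
      have h1 : (4 : ℤ) * 8 ^ m = 2 ^ (3 * m + 2) := by
        rw [pow_add, pow_mul]; norm_num; ring
      rw [h1]; push_cast
      exact pow_lt_pow_right₀ (by norm_num) (by omega)
    exact lt_of_le_of_lt hsum hpow
  -- the digits
  set N : ℕ := (zT (baseRT n) n o b u v c σ + maskN σ (4 ^ m)).toNat with hN
  have hNZ : (N : ℤ) = cubicZ (2 ^ σ) sgnT X Y Z3 + ∑ j : Fin (4 ^ m), (2 : ℤ) ^ (σ - 1) * (2 ^ σ) ^ (j : ℕ) := by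
    rw [hN, Int.toNat_of_nonneg hZ, hZeq, maskN_eq_sum σ hσpos, Fin.sum_univ_eq_sum_range
      (fun j => (2 : ℤ) ^ (σ - 1) * (2 ^ σ) ^ j) (4 ^ m)]
  have hdig : ∀ j : ℕ, j < 4 ^ m → 2 ^ (σ - 1) ≤ digit (2 ^ σ) N j :=
    digit_ge_of_land σ hσpos (4 ^ m) N hland
  have hk : ∀ k, 0 ≤ cubicCoef sgnT X Y Z3 k := cubicCoef_nonneg_of_digit_ge hσpos hB N hNZ hdig
  exact cubicForm_nonneg hk (inCube_xOf w)

/-! ## From the check to the registered inequality -/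

open Classical in
/-- **(T) from the check.**  If `checkT n o b u v c σ = true` then the covariance transfer (T) = `stub_k0CovTransferQ_c9`
holds at `(n, w, o, b, u, v, c)` for EVERY weight vector `w`. [this work] -/
theorem covTransferQ_of_checkT (o b u v c : Fin n) (σ : ℕ) (h : checkT n o b u v c σ = true)
    (w : Sym2 (Fin n) → unitInterval) :
    (prodBernoulli w).real ((openConn u v)ᶜ : Set (BondConfig (Fin n))) *
        ((prodBernoulli w).real ((openConn u v)ᶜ ∩ openConn u b ∩ openConn v o : Set (BondConfig (Fin n))) *
            (prodBernoulli w).real ((openConn c u)ᶜ ∩ (openConn c v)ᶜ : Set (BondConfig (Fin n))) -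
          (prodBernoulli w).real ((openConn u v)ᶜ ∩ openConn u b ∩ openConn v c : Set (BondConfig (Fin n))) *
            (prodBernoulli w).real ((openConn c u)ᶜ ∩ (openConn c v)ᶜ ∩ openConn o c : Set (BondConfig (Fin n)))) ≤
      (prodBernoulli w).real ((openConn u v)ᶜ ∩ openConn u b : Set (BondConfig (Fin n))) *
        ((prodBernoulli w).real ((openConn u v)ᶜ ∩ openConn v o : Set (BondConfig (Fin n))) *
            (prodBernoulli w).real ((openConn c u)ᶜ ∩ (openConn c v)ᶜ : Set (BondConfig (Fin n))) -
          (prodBernoulli w).real ((openConn u v)ᶜ ∩ openConn v c : Set (BondConfig (Fin n))) *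
            (prodBernoulli w).real ((openConn c u)ᶜ ∩ (openConn c v)ᶜ ∩ openConn o c : Set (BondConfig (Fin n)))) := by
  have key := cubicForm_nonneg_of_checkT o b u v c σ h w
  rw [cubicForm_T_eq] at key
  have e1 : connEvent (pDub u v b) = ((openConn u v)ᶜ ∩ openConn u b : Set (BondConfig (Fin n))) := by
    ext ω; simp [connEvent, pDub]
  have e2 : connEvent (pDvo u v o) = ((openConn u v)ᶜ ∩ openConn v o : Set (BondConfig (Fin n))) := by
    ext ω; simp [connEvent, pDvo]
  have e3 : connEvent (pN c u v) = ((openConn c u)ᶜ ∩ (openConn c v)ᶜ : Set (BondConfig (Fin n))) := by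
    ext ω; simp [connEvent, pN]
  have e4' : connEvent (pDvc u v c) = ((openConn u v)ᶜ ∩ openConn v c : Set (BondConfig (Fin n))) := by
    ext ω; simp [connEvent, pDvc]
  have e5 : connEvent (pNoc o c u v) = ((openConn c u)ᶜ ∩ (openConn c v)ᶜ ∩ openConn o c : Set (BondConfig (Fin n))) := by
    ext ω; simp [connEvent, pNoc, and_assoc]
  have e6 : connEvent (pD u v) = ((openConn u v)ᶜ : Set (BondConfig (Fin n))) := by
    ext ω; simp [connEvent, pD]
  have e7 : connEvent (pDubvo u v b o) = ((openConn u v)ᶜ ∩ openConn u b ∩ openConn v o : Set (BondConfig (Fin n))) := by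
    ext ω; simp [connEvent, pDubvo, and_assoc]
  have e8 : connEvent (pDubvc u v b c) = ((openConn u v)ᶜ ∩ openConn u b ∩ openConn v c : Set (BondConfig (Fin n))) := by
    ext ω; simp [connEvent, pDubvc, and_assoc]
  rw [e1, e2, e3, e4', e5, e6, e7, e8] at key
  nlinarith [key]

end Summit.CriticalPhenomena.PercolationContinuityZ3.Theorems.CovTransferCert
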